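import Summits.ResolutionOfSingularities.ResolutionOfSingularities.Theorems.FrobeniusLadderFInjectiveMacaulayficationProp44SliceCurveLocal
import Summits.ResolutionOfSingularities.ResolutionOfSingularities.Theorems.FrobeniusLadderFInjectiveMacaulayficationProp44TidyPieces
import Summits.ResolutionOfSingularities.ResolutionOfSingularities.Theorems.MarkedTransferCampaignW46ThreefoldsTauTwoSlice
import Literature.AlgebraicGeometry.Resolution.PointBlowupHsFunMono
import Literature.AlgebraicGeometry.Resolution.PointBlowupResiduallyFinite
import Literature.AlgebraicGeometry.Resolution.PointBlowupHilbertSamuelStrata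
import Literature.AlgebraicGeometry.Resolution.StrictNormalCrossingsHasSNC
import Literature.AlgebraicGeometry.Resolution.GermsOfClosedSubsets
import Literature.AlgebraicGeometry.Resolution.CohenMacaulayCatenary
import Literature.AlgebraicGeometry.Resolution.AdicCompletionRegular
import Literature.AlgebraicGeometry.Resolution.CurveCentreTwoParameters
import HarnessLib

/-!
# [CoP1] Prop. 4.4 (`CossartPiltant2008_prop44`, F-71): STEP-P — the point step of the `τ = 1` descent, from the point-step
# bookkeeping ρ1′

[L1 W4.5a · crux `FInjectiveMacaulayfication` (stmt-ResolutionOfSingularities-15315); D-0154 (2) RES inputs cell, seat res-inputs-p-8a (gen 2);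
S3 deliverable 2 (critic R51 (3)). PROVED, definition-free, no new named facts (D-0026): the one remaining input is the ORACLE HYPOTHESIS
`hρ1` = res-inputs-p-5a's residual ρ1 `pointStep_curves` (REACH signature v2 `plan/inputs/candidates/F71_REACH_DECOMPOSITION_SIGNATURE_p5a_v2.lean`
:104, binders verbatim) with its last clause in the ρ1′ form «equal OR DISJOINT closures» (p-5a, bus 09:46:49Z) — so that its prover's
theorem instantiates it by `exact`. Not a statement of the manuscript under adjudication. AI-written; AI review is weaker than expert review.]

THE POINT ([CoP1] = Cossart–Piltant 2008, proof of Prop. 4.4, pp. 10–11, structure (*): «`Σ(i)` is a disjoint union of closed points and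
projective lines»; Lemma 4.3 (1) (3) (5)). After blowing up an isolated closed threefold point `x` of the order-`m` locus, the points of
order `m` over `x` form a closed set `T₀` whose maximal points are finitely many; their closures — regular curves for the non-closed ones
(ρ1′), closed near points otherwise — are pairwise DISJOINT closed pieces. If `(W, J|_W, m)` is not order-reducible, one of the pieces,
isolated in the complement of the others, is not order-reducible (patching, Piltant 2013 Prop. 5.1; W4.6's `τ ≥ 2` point slice settles the
closed pieces with `τ ≥ 2`). This is the oracle STEP-P of the descent `orderReducible_comap_of_isolated_tau_one_of_descent`
(`…Prop44SliceTauOnePoint.lean`), in a slightly STRONGER form (no `τ(x) = 1` hypothesis is needed).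

* `orderReducible_comap_of_pieces` — patching over an open from pairwise disjoint closed pieces (relative `OrderReducible.of_opens_finite`);
* `spanFinrank_eq_three_of_isClosed` — a CLOSED point of a blowing up over a closed threefold point is a threefold point (`k(x′)/k(x)`
  finite, Stacks 01TB; dimension formula, Matsumura 15.6 / CJS (3.8));
* `exists_not_orderReducible_of_point_step` — **STEP-P from ρ1′.**

`CossartPiltant2008_prop44` is NOT proved; resolution in dimension `≥ 4` / positive characteristic is NOT proved.

References: V. Cossart, O. Piltant, J. Algebra 320 (2008), Lemma 4.3, Prop. 4.4 (proof, pp. 10–11) [CossartPiltant2008]; O. Piltant, RACSAM 107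
(2013), Prop. 5.1 [Piltant2013]; V. Cossart, U. Jannsen, S. Saito, LNM 2270 (2020), (3.8) [CossartJannsenSaito2020]; The Stacks Project, Tags
01TB, 02IZ [StacksProject].
-/

-- `Summit.<Summit>.<Sub>.Theorems` with `Sub = Summit` (single-conjunct summit, D-0017)
set_option linter.dupNamespace false

noncomputable section

open CategoryTheory CategoryTheory.Limits AlgebraicGeometry TopologicalSpace IsLocalRing
open Literature.AlgebraicGeometry.Resolution Scheme.IdealSheafData

namespace Summit.ResolutionOfSingularities.ResolutionOfSingularities.Theorems

namespace CP2008Prop44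

universe u

/-! ## §1 Plumbing: patching over an open from pairwise disjoint closed pieces -/

/-- **Patching over an open `U`, relative form of W4.6's `OrderReducible.of_opens_finite`** (Piltant 2013, Prop. 5.1, Step 2): if the
points of order `≥ m` of `U` are covered by finitely many pairwise disjoint closed (in `X`) pieces `Z i`, and `J` restricted to
`U ∖ ⋃_{j ≠ i} Z j` is order-reducible for every `i`, then `J|_U` is order-reducible. [cite: Piltant2013, Prop. 5.1 (proof, Step 2)] -/
theorem orderReducible_comap_of_pieces {X : Scheme.{u}} [IsLocallyNoetherian X] (hX : Scheme.IsRegular X) (J : X.IdealSheafData)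
    (m : ℕ) (U : X.Opens) {n : ℕ} (Z : Fin n → Set X) (hZc : ∀ i, IsClosed (Z i))
    (hdisj : ∀ i j, i ≠ j → Disjoint (Z i) (Z j))
    (hcov : ∀ z : X, z ∈ (U : Set X) → (m : ℕ∞) ≤ idealOrder J z → ∃ i, z ∈ Z i)
    (hpiece : ∀ i (V : X.Opens), (V : Set X) = (U : Set X) \ ⋃ j ∈ {j : Fin n | j ≠ i}, Z j →
      CampaignW46.OrderReducible (J.comap V.ι) m) :
    CampaignW46.OrderReducible (J.comap U.ι) m := by
  classical
  have hU : Scheme.IsRegular (U : Scheme.{u}) := Scheme.IsRegular.of_isOpenImmersion U.ι hX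
  have hcl : ∀ i : Fin n, IsClosed (⋃ j ∈ {j : Fin n | j ≠ i}, Z j) := fun i =>
    (Set.toFinite _).isClosed_biUnion fun j _ => hZc j
  -- the pieces and the opens, read in `U`
  let Z' : Fin n → Set (U : Scheme.{u}) := fun i => U.ι ⁻¹' Z i
  let V' : Fin n → (U : Scheme.{u}).Opens := fun i => ⟨(U.ι ⁻¹' ⋃ j ∈ {j : Fin n | j ≠ i}, Z j)ᶜ,
    ((hcl i).preimage U.ι.continuous).isOpen_compl⟩
  refine CampaignW46.OrderReducible.of_opens_finite n hU (J.comap U.ι) m V' Z' (fun i => (hZc i).preimage U.ι.continuous)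
    (fun i => ?_) (fun i j hij => ?_) (fun z hz => ?_) (fun i => ?_)
  · intro z hz hz'
    obtain ⟨j, hj, hzj⟩ := Set.mem_iUnion₂.mp hz'
    exact Set.disjoint_left.mp (hdisj i j (Ne.symm hj)) hz hzj
  · exact Set.disjoint_left.mpr fun z hz hzV => hzV (Set.mem_iUnion₂.mpr ⟨i, hij, hz⟩)
  · rw [idealOrder_comap_of_etale] at hz
    obtain ⟨i, hi⟩ := hcov (U.ι z) z.2 hz
    exact ⟨i, hi⟩
  · let V : X.Opens := ⟨(U : Set X) \ ⋃ j ∈ {j : Fin n | j ≠ i}, Z j, U.2.sdiff (hcl i)⟩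
    have hV := hpiece i V rfl
    have hrange : Set.range ((V' i).ι ≫ U.ι) ⊆ (V : Set X) := by
      rintro _ ⟨y, rfl⟩
      rw [Scheme.Hom.comp_apply]
      exact ⟨((V' i).ι y).2, y.2⟩
    have h := orderReducible_comap_of_range_subset J V ((V' i).ι ≫ U.ι) hrange hV
    rwa [Scheme.IdealSheafData.comap_comp] at h

/-! ## §2 Point data in the exceptional fibre -/

/-- **A closed point of the blowing up over a closed threefold point is a threefold point**: for a blowing up `π : X′ → X` of an integral
locally Noetherian scheme with regular (hence universally catenary) local ring of dimension `3` at the closed point `π x′`, and `x′` CLOSED: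
`k(x′)/k(π x′)` is finite (Stacks 01TB), so the dimension formula gives `dim 𝒪_{X′,x′} = 3`; if `𝒪_{X′,x′}` is regular its embedding
dimension is `3`. [cite: CossartJannsenSaito2020, proof of Thm. 3.10, (3.8) (p. 44)] [cite: StacksProject, Tag 01TB] -/
theorem spanFinrank_eq_three_of_isClosed {X X' : Scheme.{u}} [IsIntegral X] [IsLocallyNoetherian X] [IsLocallyNoetherian X']
    {π : X' ⟶ X} {C : X.IdealSheafData} (hπ : IsBlowup π C) {x' : X'} (hx' : IsClosed ({x'} : Set X'))
    [IsRegularLocalRing (X.presheaf.stalk (π x'))] [IsRegularLocalRing (X'.presheaf.stalk x')]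
    (hd : (maximalIdeal (X.presheaf.stalk (π x'))).spanFinrank = 3) :
    (maximalIdeal (X'.presheaf.stalk x')).spanFinrank = 3 := by
  haveI := hπ.isProper
  haveI : IsRegularRing (X.presheaf.stalk (π x')) := isRegularRing_of_isRegularLocalRing _
  have hUC : IsUniversallyCatenaryRing (X.presheaf.stalk (π x')) := isUniversallyCatenaryRing_of_isRegularRing' _
  have hfin := finite_residueFieldMap_of_isClosed π hx'
  obtain ⟨T, hTgen, hTint⟩ := exists_residuallyFinite_of_finite_residueField (π.stalkMap x').hom hfin
  have hdim := hπ.ringKrullDim_stalk_eq_of_residuallyIntegral x' hUC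
    (exists_monic_map_eval_mem_of_residuallyFinite _ T hTgen hTint)
  have h1 : ((maximalIdeal (X'.presheaf.stalk x')).spanFinrank : WithBot ℕ∞) = ringKrullDim (X'.presheaf.stalk x') :=
    IsRegularLocalRing.spanFinrank_maximalIdeal
  have h2 : ((maximalIdeal (X.presheaf.stalk (π x'))).spanFinrank : WithBot ℕ∞) =
      ringKrullDim (X.presheaf.stalk (π x')) :=
    IsRegularLocalRing.spanFinrank_maximalIdeal
  rw [hdim] at h1
  change _ = ringKrullDim (X.presheaf.stalk (π x')) at h1
  rw [← h2, hd] at h1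
  exact_mod_cast h1


/-! ## §3 STEP-P -/

/-- **STEP-P — THE POINT STEP OF THE `τ = 1` DESCENT** ([CoP1] Prop. 4.4, proof p. 10–11 with Lemma 4.3 (1) (3) (5) and the structure
(*) «`Σ(i)` is a disjoint union of closed points and projective lines»). `X` integral Noetherian regular quasi-excellent of dimension `≤ 3`,
`J` with `ord ≤ m`, `V(J)` of codimension `≥ 2`; `W ∋ x` open, `x` a closed threefold point of order `m` with `τ(x) = 1`, isolated among
the points of order `≥ m` of `W`; `π : X′ → X` a blowing up of `x`, `J′` the weak transform; `(W, J|_W, m)` NOT order-reducible. THEN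
EITHER (P1) some near CLOSED threefold point `x′` over `x` with `τ(x′) = 1`, isolated in an open `W′ ⊆ π⁻¹W`, has `(W′, J′|_{W′}, m)` not
order-reducible, OR (P2) some non-closed near point `η′` over `x` (of codimension `2`) has regular closure `L = cl{η′}` (a line of the
exceptional plane), contained in an open `W′ ⊆ π⁻¹W` whose points of order `≥ m` all lie on `L`, with `ord J′ = m` along `L` and
`(W′, J′|_{W′}, m)` not order-reducible. GIVEN the point-step bookkeeping ρ1′ (oracle `hρ1`: res-inputs-p-5a's `pointStep_curves` with
its last clause in the «equal or disjoint» form): the maximal points of the near locus `T₀ = {ord J′ ≥ m} ∩ π⁻¹(x)` are finitely many,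
their closures are pairwise disjoint closed pieces (regular curves for the non-closed ones, by ρ1′), closed near points are threefold
points (`spanFinrank_eq_three_of_isClosed`), those with `τ ≥ 2` are settled by W4.6's `orderReducible_comap_of_isolated_two_le_tau`,
and if every piece were settled, patching (`orderReducible_comap_of_pieces`) and the blowing up would settle `(W, J|_W, m)`.
[cite: CossartPiltant2008, Prop. 4.4 (proof, pp. 10–11), Lemma 4.3 (1) (3) (5)] [cite: Piltant2013, Prop. 5.1 (proof, Step 2)] -/
theorem exists_not_orderReducible_of_point_step {m : ℕ} (hm : 1 ≤ m)
    (hρ1 : ∀ ⦃X X' : Scheme.{u}⦄ [IsLocallyNoetherian X] [IsLocallyNoetherian X'] (_hX : Scheme.IsRegular X)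
      (_hX3 : topologicalKrullDim X ≤ 3) (J : X.IdealSheafData) ⦃μ : ℕ⦄ (_hμ : 1 ≤ μ) (_hle : ∀ z, idealOrder J z ≤ μ)
      (_hcodim : ∀ z ∈ J.support, 1 < Order.coheight z) ⦃x : X⦄ (hx : IsClosed ({x} : Set X)) (_hord : idealOrder J x = μ)
      (_hdim : (maximalIdeal (X.presheaf.stalk x)).spanFinrank = 3) ⦃π : X' ⟶ X⦄
      (_hπ : IsBlowup π (vanishingIdeal ⟨{x}, hx⟩)) ⦃η' : X'⦄
      (_hη' : η' ∈ maxPoints {z : X' | (μ : ℕ∞) ≤ idealOrder (controlledTransform π (vanishingIdeal ⟨{x}, hx⟩) J μ) z})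
      (_hη'cl : ¬ IsClosed ({η'} : Set X')),
      (π η' ≠ x ∧ π η' ∈ maxPoints {z : X | (μ : ℕ∞) ≤ idealOrder J z} ∧
          closure ({η'} : Set X') = closure (π ⁻¹' (closure {π η'} \ {x}))) ∨
        (π η' = x ∧ Scheme.IsRegular (vanishingIdeal (⟨closure {η'}, isClosed_closure⟩ : Closeds X')).subscheme ∧
          (∀ y ∈ closure ({η'} : Set X'), ∀ hr : IsRegularLocalRing (X'.presheaf.stalk y),
            ∃ c : Fin 2 → X'.presheaf.stalk y, @IsRsopPart _ _ _ 2 c ∧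
              Ideal.span (Set.range c) = stalkIdeal (vanishingIdeal (⟨closure {η'}, isClosed_closure⟩ : Closeds X')) y) ∧
          ∀ η'' ∈ maxPoints {z : X' | (μ : ℕ∞) ≤ idealOrder (controlledTransform π (vanishingIdeal ⟨{x}, hx⟩) J μ) z},
            ¬ IsClosed ({η''} : Set X') → π η'' = x → η'' = η' ∨ Disjoint (closure ({η'} : Set X')) (closure {η''})))
    {X : Scheme.{u}} [IsIntegral X] [IsNoetherian X] (hX : Scheme.IsRegular X) (hqe : Scheme.IsQuasiExcellent X)
    (hX3 : topologicalKrullDim X ≤ 3) (J : X.IdealSheafData) (hle : ∀ z, idealOrder J z ≤ m)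
    (hcodim : ∀ z ∈ J.support, 1 < Order.coheight z) (W : X.Opens) (x : X) (hxW : x ∈ W)
    (hcl : IsClosed ({x} : Set X)) (hbad : ∀ z : X, (m : ℕ∞) ≤ idealOrder J z → z = x ∨ z ∉ (W : Set X))
    (hord : idealOrder J x = m) (hdim : (maximalIdeal (X.presheaf.stalk x)).spanFinrank = 3)
    {X' : Scheme.{u}} (π : X' ⟶ X) (hπ : IsBlowup π (vanishingIdeal ⟨{x}, hcl⟩))
    (hnot : ¬ CampaignW46.OrderReducible (J.comap W.ι) m) :
    (∃ (_ : IsIntegral X') (_ : IsNoetherian X') (hX' : Scheme.IsRegular X') (_ : Scheme.IsQuasiExcellent X')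
      (_ : topologicalKrullDim X' ≤ 3) (_ : ∀ z, idealOrder (controlledTransform π (vanishingIdeal ⟨{x}, hcl⟩) J m) z ≤ m)
      (_ : ∀ z ∈ (controlledTransform π (vanishingIdeal ⟨{x}, hcl⟩) J m).support, 1 < Order.coheight z)
      (x' : X') (_ : π x' = x) (_ : IsNear π (vanishingIdeal ⟨{x}, hcl⟩) J m x') (W' : X'.Opens) (_ : x' ∈ W')
      (_ : W' ≤ π ⁻¹ᵁ W) (_ : IsClosed ({x'} : Set X'))
      (_ : ∀ z : X', (m : ℕ∞) ≤ idealOrder (controlledTransform π (vanishingIdeal ⟨{x}, hcl⟩) J m) z → z = x' ∨ z ∉ (W' : Set X'))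
      (_ : idealOrder (controlledTransform π (vanishingIdeal ⟨{x}, hcl⟩) J m) x' = m)
      (_ : (maximalIdeal (X'.presheaf.stalk x')).spanFinrank = 3)
      (_ : haveI := hX' x'; stalkTau (controlledTransform π (vanishingIdeal ⟨{x}, hcl⟩) J m) x' m = 1)
      (_ : IsGRing (X'.presheaf.stalk x')),
      ¬ CampaignW46.OrderReducible ((controlledTransform π (vanishingIdeal ⟨{x}, hcl⟩) J m).comap W'.ι) m) ∨
    (∃ (_ : IsIntegral X') (_ : IsNoetherian X') (_ : Scheme.IsRegular X') (_ : Scheme.IsQuasiExcellent X')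
      (_ : topologicalKrullDim X' ≤ 3) (_ : ∀ z, idealOrder (controlledTransform π (vanishingIdeal ⟨{x}, hcl⟩) J m) z ≤ m)
      (_ : ∀ z ∈ (controlledTransform π (vanishingIdeal ⟨{x}, hcl⟩) J m).support, 1 < Order.coheight z)
      (η' : X') (_ : π η' = x) (_ : Order.coheight η' = 2)
      (_ : Scheme.IsRegular (vanishingIdeal (⟨closure {η'}, isClosed_closure⟩ : Closeds X')).subscheme)
      (W' : X'.Opens) (_ : closure ({η'} : Set X') ⊆ (W' : Set X')) (_ : W' ≤ π ⁻¹ᵁ W)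
      (_ : ∀ z : X', (m : ℕ∞) ≤ idealOrder (controlledTransform π (vanishingIdeal ⟨{x}, hcl⟩) J m) z →
        z ∈ closure ({η'} : Set X') ∨ z ∉ (W' : Set X'))
      (_ : ∀ y ∈ closure ({η'} : Set X'), idealOrder (controlledTransform π (vanishingIdeal ⟨{x}, hcl⟩) J m) y = m),
      ¬ CampaignW46.OrderReducible ((controlledTransform π (vanishingIdeal ⟨{x}, hcl⟩) J m).comap W'.ι) m) := by
  classical
  -- §a the blowing up and the invariants of `X'`
  set D : Closeds X := ⟨{x}, hcl⟩ with hDdef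
  have hreg : Scheme.IsRegular (vanishingIdeal D).subscheme := CampaignW46.isRegular_subscheme_vanishingIdeal_singleton hcl
  have hY : ∀ y ∈ (D : Set X), idealOrder J y = m := fun y hy => by
    rw [show y = x from hy]; exact hord
  have hDm : ∀ y ∈ (D : Set X), (m : ℕ∞) ≤ idealOrder J y := fun y hy => (hY y hy).ge
  have hseq1 : CampaignW46.IsPermissibleBlowupSeq J m π (controlledTransform π (vanishingIdeal D) J m) :=
    CampaignW46.IsPermissibleBlowupSeq.single D π hreg hDm hπ
  obtain ⟨hint', hnoeth', hX', hqe', hle', hcodim'⟩ := IsPermissibleBlowupSeq.prop44Invariants hX hqe hm hle hcodim hseq1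
  haveI := hint'
  haveI := hnoeth'
  have hX3' : topologicalKrullDim X' ≤ 3 := hπ.topologicalKrullDim_le hX3
  have hcoh3' : ∀ z : X', Order.coheight z ≤ 3 := (topologicalKrullDim_le_iff_forall_coheight_le X' 3).mp hX3'
  haveI : IsRegularLocalRing (X.presheaf.stalk x) := hX x
  set J' := controlledTransform π (vanishingIdeal D) J m with hJ'def
  -- §b the points of order `≥ m`: near points over `x`, or over the complement of `W`
  have hoff : ∀ z : X', π z ≠ x → (m : ℕ∞) ≤ idealOrder J' z → π z ∉ (W : Set X) := by
    intro z hπz hz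
    have hz' : π z ∉ ((vanishingIdeal D).support : Set X) := by
      rw [Scheme.IdealSheafData.coe_support_vanishingIdeal]; exact hπz
    rw [hJ'def, hπ.idealOrder_controlledTransform_of_not_mem J m hz'] at hz
    rcases hbad (π z) hz with h | h
    · exact absurd h hπz
    · exact h
  have hnear_of : ∀ z : X', π z = x → (m : ℕ∞) ≤ idealOrder J' z → IsNear π (vanishingIdeal D) J m z := by
    intro z hπz hz
    have hle := hπ.idealOrder_controlledTransform_le_of_mem hX hreg hY (x' := z) (by rw [hπz]; rfl)
    exact isNear_iff.mpr (le_antisymm hle hz)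
  -- §c the near locus over `x` and its maximal points
  set T₀ : Set X' := {z : X' | (m : ℕ∞) ≤ idealOrder J' z ∧ π z = x} with hT₀def
  have hJ'ne : J' ≠ ⊥ := ne_bot_of_forall_one_lt_coheight hcodim'
  have hOrdCl : IsClosed {z : X' | (m : ℕ∞) ≤ idealOrder J' z} :=
    isClosed_setOf_le_idealOrder_of_isJ2 hX' (fun U => (hqe' U).isJ2Ring) hJ'ne m
  have hT₀cl : IsClosed T₀ := by
    have h2 : IsClosed {z : X' | π z = x} := hcl.preimage π.continuous
    exact hOrdCl.inter h2
  have hT₀W : T₀ ⊆ ((π ⁻¹ᵁ W : X'.Opens) : Set X') := fun z hz => by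
    show π z ∈ (W : Set X); rw [hz.2]; exact hxW
  have hT₀max : maxPoints T₀ ⊆ maxPoints {z : X' | (m : ℕ∞) ≤ idealOrder J' z} := by
    intro η hη
    refine ⟨hη.1.1, fun ζ hζ hζη => hη.2 ζ ⟨hζ, ?_⟩ hζη⟩
    by_contra hne
    have h1 := hoff ζ hne hζ
    have h2 : π ζ ⤳ π η := hζη.map π.continuous
    rw [hη.1.2] at h2
    exact h1 (h2.mem_open W.2 hxW)
  -- §d the pieces: the closures of the (finitely many) maximal points of `T₀`
  have hMfin : (maxPoints T₀).Finite := finite_maxPoints hT₀cl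
  haveI : Fintype (maxPoints T₀) := hMfin.fintype
  obtain ⟨n, ⟨e⟩⟩ : ∃ n, Nonempty ((maxPoints T₀) ≃ Fin n) := ⟨_, ⟨Fintype.equivFin _⟩⟩
  let η : Fin n → X' := fun i => ((e.symm i : maxPoints T₀) : X')
  have hηM : ∀ i, η i ∈ maxPoints T₀ := fun i => (e.symm i).2
  have hηinj : Function.Injective η := fun i j h => e.symm.injective (Subtype.ext h)
  let Z : Fin n → Set X' := fun i => closure {η i}
  have hZT : ∀ i, Z i ⊆ T₀ := fun i => closure_minimal (Set.singleton_subset_iff.mpr (hηM i).1) hT₀cl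
  have hZc : ∀ i, IsClosed (Z i) := fun i => isClosed_closure
  -- ρ1′ at the non-closed maximal points
  have hρ : ∀ i, ¬ IsClosed ({η i} : Set X') →
      Scheme.IsRegular (vanishingIdeal (⟨closure {η i}, isClosed_closure⟩ : Closeds X')).subscheme ∧
        ∀ j, ¬ IsClosed ({η j} : Set X') → η j = η i ∨ Disjoint (closure ({η i} : Set X')) (closure {η j}) := by
    intro i hi
    rcases hρ1 hX hX3 J hm hle hcodim hcl hord hdim hπ (hT₀max (hηM i)) hi with ⟨hne, -, -⟩ | ⟨-, hregi, -, huniq⟩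
    · exact absurd (hηM i).1.2 hne
    · exact ⟨hregi, fun j hj => huniq (η j) (hT₀max (hηM j)) hj (hηM j).1.2⟩
  -- the pieces are pairwise disjoint
  have hdisj : ∀ i j, i ≠ j → Disjoint (Z i) (Z j) := by
    intro i j hij
    have hne : η i ≠ η j := fun h => hij (hηinj h)
    by_cases hi : IsClosed ({η i} : Set X')
    · have hZi : Z i = {η i} := hi.closure_eq
      rw [hZi]
      refine Set.disjoint_singleton_left.mpr fun h => hne ?_
      exact ((hηM i).2 (η j) (hηM j).1 (specializes_iff_mem_closure.mpr h)).symm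
    · by_cases hj : IsClosed ({η j} : Set X')
      · have hZj : Z j = {η j} := hj.closure_eq
        rw [hZj]
        refine Set.disjoint_singleton_right.mpr fun h => hne ?_
        exact (hηM j).2 (η i) (hηM i).1 (specializes_iff_mem_closure.mpr h)
      · rcases (hρ i hi).2 j hj with h | h
        · exact absurd h.symm hne
        · exact h
  -- the pieces cover the points of order `≥ m` over `W`
  have hcov : ∀ z : X', z ∈ ((π ⁻¹ᵁ W : X'.Opens) : Set X') → (m : ℕ∞) ≤ idealOrder J' z → ∃ i, z ∈ Z i := by
    intro z hzW hz
    have hzT : z ∈ T₀ := by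
      refine ⟨hz, ?_⟩
      by_contra hne
      exact hoff z hne hz hzW
    obtain ⟨ζ, hζM, hζz⟩ := exists_mem_maxPoints_specializes hT₀cl hzT
    refine ⟨e ⟨ζ, hζM⟩, ?_⟩
    have hη : η (e ⟨ζ, hζM⟩) = ζ := by
      show ((e.symm (e ⟨ζ, hζM⟩) : maxPoints T₀) : X') = ζ
      rw [Equiv.symm_apply_apply]
    show z ∈ closure {η (e ⟨ζ, hζM⟩)}
    rw [hη]
    exact specializes_iff_mem_closure.mp hζz
  -- §e if every piece were settled, `(W, J|_W, m)` would be order-reducible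
  by_contra hnone
  push Not at hnone
  obtain ⟨h1, h2⟩ := hnone
  apply hnot
  refine orderReducible_comap_of_seq_of_comap_preimage hseq1 W ?_
  refine orderReducible_comap_of_pieces hX' J' m (π ⁻¹ᵁ W) Z hZc hdisj hcov fun i V hV => ?_
  have hVW : V ≤ π ⁻¹ᵁ W := fun z hz => by
    have hz' : z ∈ (V : Set X') := hz
    rw [hV] at hz'
    exact hz'.1
  have hZV : Z i ⊆ (V : Set X') := by
    intro z hz
    rw [hV]
    refine ⟨hT₀W (hZT i hz), fun h => ?_⟩
    obtain ⟨j, hj, hzj⟩ := Set.mem_iUnion₂.mp h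
    exact Set.disjoint_left.mp (hdisj i j (Ne.symm hj)) hz hzj
  have hbadV : ∀ z : X', (m : ℕ∞) ≤ idealOrder J' z → z ∈ Z i ∨ z ∉ (V : Set X') := by
    intro z hz
    by_cases hzV : z ∈ (V : Set X')
    · left
      obtain ⟨j, hj⟩ := hcov z (hVW hzV) hz
      by_cases hji : j = i
      · exact hji ▸ hj
      · exfalso
        rw [hV] at hzV
        exact hzV.2 (Set.mem_iUnion₂.mpr ⟨j, hji, hj⟩)
    · exact Or.inr hzV
  have hπη : π (η i) = x := (hηM i).1.2
  by_cases hi : IsClosed ({η i} : Set X')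
  · -- a closed near point: settled by the point oracle (`τ = 1`) or by W4.6's `τ ≥ 2` slice
    have hZi : Z i = {η i} := hi.closure_eq
    have hnear : IsNear π (vanishingIdeal D) J m (η i) := hnear_of _ hπη (hηM i).1.1
    have hordη : idealOrder J' (η i) = m := isNear_iff.mp hnear
    haveI : IsRegularLocalRing (X'.presheaf.stalk (η i)) := hX' _
    haveI : IsRegularLocalRing (X.presheaf.stalk (π (η i))) := hX _
    have hdimη : (maximalIdeal (X'.presheaf.stalk (η i))).spanFinrank = 3 :=
      spanFinrank_eq_three_of_isClosed hπ hi (by rw [CampaignW46.spanFinrank_maximalIdeal_congr hπη]; exact hdim)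
    have hG : IsGRing (X'.presheaf.stalk (η i)) := Scheme.isGRing_stalk_of_isQuasiExcellent hqe' _
    have hηV : η i ∈ V := hZV (by rw [hZi]; exact Set.mem_singleton _)
    have hbadV' : ∀ z : X', (m : ℕ∞) ≤ idealOrder J' z → z = η i ∨ z ∉ (V : Set X') := fun z hz =>
      (hbadV z hz).imp (fun h => by rw [hZi] at h; exact h) id
    by_cases hτi : stalkTau J' (η i) m = 1
    · exact h1 hint' hnoeth' hX' hqe' hX3' hle' hcodim' (η i) hπη hnear V hηV hVW hi hbadV' hordη hdimη hτi hG
    · have hτ2 : 2 ≤ stalkTau J' (η i) m := by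
        have h : 1 ≤ stalkTau J' (η i) m := hnear.one_le_stalkTau hm
        omega
      exact CampaignW46.orderReducible_comap_of_isolated_two_le_tau hX' J' hm V (η i) hηV hi hbadV' hordη hdimη hτ2 hG
  · -- a curve: settled by the curve oracle
    obtain ⟨hregL, -⟩ := hρ i hi
    have hsupp : η i ∈ J'.support := by
      rw [← one_le_idealOrder_iff]
      exact le_trans (by exact_mod_cast hm) (hηM i).1.1
    have hcoh : Order.coheight (η i) = 2 := coheight_eq_two_of_not_isClosed hcoh3' (hcodim' _ hsupp) hi
    have hordZ : ∀ y ∈ Z i, idealOrder J' y = m := fun y hy => le_antisymm (hle' y) (hZT i hy).1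
    exact h2 hint' hnoeth' hX' hqe' hX3' hle' hcodim' (η i) hπη hcoh hregL V hZV hVW hbadV hordZ

end CP2008Prop44

end Summit.ResolutionOfSingularities.ResolutionOfSingularities.Theorems

end
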